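import Mathlib
import Summits.CriticalPhenomena.Ising3DConformalLimit.Theorems.ModularQuarterTurnQuarterTurnAnchorsTrace
import Summits.CriticalPhenomena.Ising3DConformalLimit.Theses.ModularQuarterTurn
import HarnessLib

/-!
# `QuarterTurnAnchors` (item stmt-CriticalPhenomena-6495 of route `ModularQuarterTurn`): PROOF —
# `B = ctm⁴ / Z`, its positive fourth root, and the trace identity

For every box size `L`, with `P, E, Pr, B` as in the route statement (critical temperature, zero
field, `+` boundary condition), `A = cfc (·^{1/4}) B` the positive fourth root, and all observables
`g₀,…,g₃` of the configuration of the half-plane `P`,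
`Tr (A·diag g₃·A·diag g₂·A·diag g₁·A·diag g₀) = ⟨∏_k g_k ((ω ∘ Rᵏ)|_P)⟩_{Λ,β_c,+}`,
`R (y₀,y₁,y₂) = (-y₁,y₀,y₂)` — `quarterTurnAnchors_proof`, literally the route decl, as the case
`β = β_c(3)` of `quarterTurnAnchors_beta` (every `β`).

Ingredients (this file): the plane marginal through Baxter's corner transfer matrix,
`Pr σ η = (ctm²)(σ, jn σ η)² / Z` (trace formula of `…AnchorsTrace` with the walls `P` and `R²P`
pinned); the Gram kernel `B = Z⁻¹ ctm⁴` (hinge block structure + the bijection `η ↦ jn σ η`);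
uniqueness of positive fourth roots in functional-calculus form, `cfc (·^{1/4}) (N⁴) = N` for a
positive semidefinite real matrix `N` (`cfc_comp_pow`, the spectrum of `N` is `≥ 0`), whence
`A = Z^{-1/4} ctm` since `ctm` is symmetric positive semidefinite (`…AnchorsCorner`, reflection
positivity in the diagonal site plane); and the trace identity via `Tr Xᵀ = Tr X` and the
corner-transfer-matrix trace formula.  No hypotheses, no named facts (Baxter 1976; Friedli–Velenik
2017 §3.1, §10.3; Fradkin–Moore 2006 for the Gram form).
-/

namespace Summit.CriticalPhenomena.Ising3DConformalLimit.QuarterTurnCTM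

open Literature.Probability.LatticeModels Finset
open scoped Matrix

section

variable (L : ℕ) (β : ℝ)

/-- The half turn of a site of `E` is off the hinge. [folklore] -/
theorem rotR_rotR_apply_zero_ne {y : Site 3} (hy : y ∈ wallE L) : rotR (rotR y) 0 ≠ 0 := by
  rw [mem_wallE] at hy
  simp only [rotR_apply_zero, rotR_apply_one]
  omega

/-- `R⁴ = id`, pointwise. [folklore] -/
theorem rotR_four (y : Site 3) : rotR (rotR (rotR (rotR y))) = y := rotR_iterate_four y

/-- On the hinge the merged configuration is `σ`. [folklore] -/
theorem jn_hinge (σ : ↥(wallP L) → ℤˣ) (η : ↥(wallE L) → ℤˣ) (x : ↥(wallP L)) (hx : x.1 0 = 0) :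
    jn L σ η x = σ x := by
  simp [jn, hx]

/-- The merged configuration depends on `σ` only through its hinge values. [folklore] -/
theorem jn_congr {σ σ' : ↥(wallP L) → ℤˣ} (h : ∀ x : ↥(wallP L), x.1 0 = 0 → σ' x = σ x)
    (η : ↥(wallE L) → ℤˣ) : jn L σ' η = jn L σ η := by
  funext x
  by_cases hx : x.1 0 = 0
  · simp [jn, hx, h x hx]
  · simp [jn, hx]

/-- Transporting the merged configuration back to `E` returns `η`. [folklore] -/
theorem toE_jn (σ : ↥(wallP L) → ℤˣ) (η : ↥(wallE L) → ℤˣ) : toE L (jn L σ η) = η := by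
  funext y
  simp only [toE, jn, dif_neg (rotR_rotR_apply_zero_ne L y.2)]
  congr 1
  exact Subtype.ext (rotR_four y.1)

/-- A wall configuration agreeing with `σ` on the hinge is the merge of `σ` with its own transport to `E`. [folklore] -/
theorem jn_toE {σ ν : ↥(wallP L) → ℤˣ} (h : ∀ x : ↥(wallP L), x.1 0 = 0 → ν x = σ x) :
    jn L σ (toE L ν) = ν := by
  funext x
  by_cases hx : x.1 0 = 0
  · rw [jn_hinge L σ _ x hx, h x hx]
  · simp only [jn, dif_neg hx, toE]
    congr 1
    exact Subtype.ext (rotR_four x.1)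

/-- `ctm²` is symmetric. [folklore] -/
theorem ctmSq_symm (s s' : ↥(wallP L) → ℤˣ) : (ctm L β * ctm L β) s' s = (ctm L β * ctm L β) s s' := by
  simp only [Matrix.mul_apply]
  exact Finset.sum_congr rfl fun ν _ => by rw [ctm_symm L β ν s, ctm_symm L β s' ν, mul_comm]

/-- `ctm²` has nonnegative entries. [folklore] -/
theorem ctmSq_nonneg (s s' : ↥(wallP L) → ℤˣ) : 0 ≤ (ctm L β * ctm L β) s s' := by
  rw [Matrix.mul_apply]
  exact Finset.sum_nonneg fun ν _ => mul_nonneg (ctm_nonneg L β s ν) (ctm_nonneg L β ν s')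

/-- `ctm²` is block diagonal in the hinge configuration. [folklore] -/
theorem hinge_eq_of_ctmSq_ne_zero {s s' : ↥(wallP L) → ℤˣ} (h : (ctm L β * ctm L β) s s' ≠ 0) :
    ∀ x : ↥(wallP L), x.1 0 = 0 → s x = s' x := by
  rw [Matrix.mul_apply] at h
  obtain ⟨ν, -, hν⟩ := Finset.exists_ne_zero_of_sum_ne_zero h
  intro x hx
  rw [hinge_eq_of_ctm_ne_zero L β (left_ne_zero_of_mul hν) x hx,
    hinge_eq_of_ctm_ne_zero L β (right_ne_zero_of_mul hν) x hx]

/-- Pinning the walls `P` and `R² P` in the trace formula: `∑_τ w(τ) [ω|_P = σ] [ω∘R²|_P = ν] =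
(ctm²)(σ,ν) · (ctm²)(ν,σ)`. [folklore] -/
theorem sum_isingWeight_two_walls (σ ν : ↥(wallP L) → ℤˣ) :
    ∑ τ : ↥(box 3 L) → ℤˣ, isingWeight (zdGraph 3) (box 3 L) β 0 .plus τ *
      ((if wallRes L 0 τ = σ then (1:ℝ) else 0) * (if wallRes L 2 τ = ν then (1:ℝ) else 0)) =
    (ctm L β * ctm L β) σ ν * (ctm L β * ctm L β) ν σ := by
  have hm := sum_isingWeight_mul_eq L β
    (fun s => (if s 0 = σ then (1:ℝ) else 0) * (if s 2 = ν then (1:ℝ) else 0))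
  rw [show (∑ τ : ↥(box 3 L) → ℤˣ, isingWeight (zdGraph 3) (box 3 L) β 0 .plus τ *
      ((if wallRes L 0 τ = σ then (1:ℝ) else 0) * (if wallRes L 2 τ = ν then (1:ℝ) else 0))) = _ from hm,
    sum_fin_four_pi]
  simp only [Fin.prod_univ_four, Fin.isValue, Matrix.cons_val_zero, Matrix.cons_val_one, Matrix.cons_val,
    show ((3 : Fin 4) + 1) = 0 from rfl, show ((2 : Fin 4) + 1) = 3 from rfl,
    show ((1 : Fin 4) + 1) = 2 from rfl, show ((0 : Fin 4) + 1) = 1 from rfl]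
  rw [Finset.sum_eq_single σ]
  · simp only [if_true, one_mul]
    rw [Finset.sum_comm, Finset.sum_eq_single ν]
    · simp only [if_true, mul_one, Matrix.mul_apply, Finset.sum_mul_sum]
      exact Finset.sum_congr rfl fun b _ => Finset.sum_congr rfl fun d _ => by ring
    · intro c _ hc; simp [hc]
    · intro h; exact absurd (Finset.mem_univ _) h
  · intro a _ ha; simp [ha]
  · intro h; exact absurd (Finset.mem_univ _) h

/-- The plane indicator observable through the walls `P` and `R² P`: for `ω = τ` glued with `+`,
`[ω|_P = σ] · [ω|_E = η] = [ω|_P = σ] · [ω∘R²|_P = jn σ η]`. [folklore] -/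
theorem planeIndicator_eq (τ : ↥(box 3 L) → ℤˣ) (σ : ↥(wallP L) → ℤˣ) (η : ↥(wallE L) → ℤˣ) :
    (∏ x : ↥(wallP L), if glue (box 3 L) τ .plus x.1 = σ x then (1:ℝ) else 0) *
      (∏ y : ↥(wallE L), if glue (box 3 L) τ .plus y.1 = η y then (1:ℝ) else 0) =
    (if wallRes L 0 τ = σ then (1:ℝ) else 0) * (if wallRes L 2 τ = jn L σ η then (1:ℝ) else 0) := by
  rw [Fintype.prod_boole, Fintype.prod_boole]
  have h0 : (∀ x : ↥(wallP L), glue (box 3 L) τ .plus x.1 = σ x) ↔ wallRes L 0 τ = σ := by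
    rw [funext_iff]; rfl
  by_cases hσ : wallRes L 0 τ = σ
  · rw [if_pos (h0.2 hσ), if_pos hσ, one_mul, one_mul]
    refine if_congr ⟨fun h => ?_, fun h => ?_⟩ rfl rfl
    · funext x
      by_cases hx : x.1 0 = 0
      · rw [jn_hinge L σ η x hx, ← hσ]
        have hx1 : x.1 1 = 0 := (mem_wallP.1 x.2).2.1
        have hRR : rotR (rotR x.1) = x.1 := by
          rw [site_ext_iff]
          simp only [rotR_apply_zero, rotR_apply_one, rotR_apply_two, and_true]
          omega
        show glue (box 3 L) τ .plus (rotR (rotR x.1)) = glue (box 3 L) τ .plus x.1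
        rw [hRR]
      · simp only [jn, dif_neg hx]
        exact h ⟨rotR (rotR x.1), rotR_rotR_mem_wallE L x.2 hx⟩
    · intro y
      have := congrFun h ⟨rotR (rotR y.1), rotR_rotR_mem_wallP L y.2⟩
      simp only [wallRes, jn, dif_neg (rotR_rotR_apply_zero_ne L y.2)] at this
      rw [show rotR^[2] (rotR (rotR y.1)) = y.1 from rotR_four y.1] at this
      rw [this]
      congr 1
      exact Subtype.ext (rotR_four y.1)
  · rw [if_neg (fun h => hσ (h0.1 h)), if_neg hσ, zero_mul, zero_mul]

/-- **The plane marginal through the corner transfer matrix**: `Pr σ η = (ctm²)(σ, jn σ η)² / Z`.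
[folklore] -/
theorem prE_eq (σ : ↥(wallP L) → ℤˣ) (η : ↥(wallE L) → ℤˣ) : prE L β σ η =
    ((ctm L β * ctm L β) σ (jn L σ η)) ^ 2 / isingPartitionFunction (zdGraph 3) (box 3 L) β 0 .plus := by
  have hmeas : Measurable fun ω : SpinConfig (Site 3) =>
      (∏ x : ↥(wallP L), if ω x.1 = σ x then (1:ℝ) else 0) *
        ∏ y : ↥(wallE L), if ω y.1 = η y then (1:ℝ) else 0 :=
    (Finset.measurable_prod _ fun x _ => measurable_ite_apply_eq x.1 (σ x)).mul
      (Finset.measurable_prod _ fun y _ => measurable_ite_apply_eq y.1 (η y))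
  rw [prE, isingExpect, integral_isingMeasure _ _ _ _ _ hmeas]
  congr 1
  simp_rw [planeIndicator_eq]
  rw [sum_isingWeight_two_walls, ctmSq_symm L β σ (jn L σ η), sq]

/-- **The Gram kernel is the fourth power of the corner transfer matrix over the partition function**:
`B = Z⁻¹ · ctm⁴` (Baxter 1976: the product of the four corner transfer matrices around the hinge is the
cut density matrix; the Gram form `∑_η √(Pr Pr')` is that of Fradkin–Moore 2006). [folklore] -/
theorem bMat_eq : bMat L β = (isingPartitionFunction (zdGraph 3) (box 3 L) β 0 .plus)⁻¹ • (ctm L β) ^ 4 := by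
  have hZpos : 0 < isingPartitionFunction (zdGraph 3) (box 3 L) β 0 .plus := isingPartitionFunction_pos _ _ _ _ _
  have h4 : ctm L β ^ 4 = (ctm L β * ctm L β) * (ctm L β * ctm L β) := by
    rw [show 4 = 2 + 2 from rfl, pow_add, sq]
  ext σ' σ
  rw [bMat, Matrix.of_apply, Matrix.smul_apply, smul_eq_mul, h4,
    Matrix.mul_apply (M := ctm L β * ctm L β) (N := ctm L β * ctm L β)]
  by_cases h : ∀ x : ↥(wallP L), x.1 0 = 0 → σ' x = σ x
  · rw [if_pos h]
    -- each summand is `M(σ', J) M(J, σ) / Z` with `M = ctm²`, `J = jn σ η`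
    have hterm : ∀ η, Real.sqrt (prE L β σ' η * prE L β σ η) =
        (isingPartitionFunction (zdGraph 3) (box 3 L) β 0 .plus)⁻¹ *
          ((ctm L β * ctm L β) σ' (jn L σ η) * (ctm L β * ctm L β) (jn L σ η) σ) := by
      intro η
      rw [prE_eq, prE_eq, jn_congr L h, ctmSq_symm L β σ (jn L σ η), div_mul_div_comm, ← mul_pow,
        Real.sqrt_div' _ (mul_self_nonneg _),
        Real.sqrt_sq (mul_nonneg (ctmSq_nonneg L β _ _) (ctmSq_nonneg L β _ _)),
        Real.sqrt_mul_self hZpos.le, div_eq_inv_mul]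
    simp_rw [hterm]
    rw [← Finset.mul_sum]
    refine congrArg _ ?_
    -- reindex `η ↦ jn σ η` onto the wall configurations agreeing with `σ` on the hinge
    rw [← Finset.sum_filter_of_ne (s := Finset.univ)
      (p := fun ν : ↥(wallP L) → ℤˣ => ∀ x : ↥(wallP L), x.1 0 = 0 → ν x = σ x)
      (fun ν _ hν x hx => (hinge_eq_of_ctmSq_ne_zero L β (right_ne_zero_of_mul hν) x hx))]
    symm
    refine Finset.sum_nbij' (toE L) (jn L σ) (fun _ _ => Finset.mem_univ _) (fun η _ => ?_) (fun ν hν => ?_)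
      (fun η _ => toE_jn L σ η) (fun ν hν => ?_)
    · exact Finset.mem_filter.2 ⟨Finset.mem_univ _, fun x hx => jn_hinge L σ η x hx⟩
    · exact jn_toE L (Finset.mem_filter.1 hν).2
    · rw [jn_toE L (Finset.mem_filter.1 hν).2]
  · rw [if_neg h]
    symm
    refine mul_eq_zero_of_right _ (Finset.sum_eq_zero fun ν _ => ?_)
    by_contra hν
    apply h
    intro x hx
    rw [hinge_eq_of_ctmSq_ne_zero L β (left_ne_zero_of_mul hν) x hx,
      hinge_eq_of_ctmSq_ne_zero L β (right_ne_zero_of_mul hν) x hx]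

/-- **Uniqueness of positive fourth roots**, functional-calculus form: for a positive semidefinite real
matrix `N`, `(N⁴)^{1/4} = N` (`cfc` of `x ↦ x^{1/4}`). [folklore] -/
theorem cfc_rpow_quarter_pow_four {ι : Type*} [Fintype ι] [DecidableEq ι] {N : Matrix ι ι ℝ}
    (hN : N.PosSemidef) : cfc (fun x : ℝ => x ^ (1 / 4 : ℝ)) (N ^ 4) = N := by
  have hsa : IsSelfAdjoint N := hN.1.isSelfAdjoint
  have hcont : Continuous fun x : ℝ => x ^ (1 / 4 : ℝ) := Real.continuous_rpow_const (by norm_num)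
  have hspec : ∀ x ∈ spectrum ℝ N, 0 ≤ x := by
    intro x hx
    rw [hN.1.spectrum_real_eq_range_eigenvalues] at hx
    obtain ⟨i, rfl⟩ := hx
    exact hN.eigenvalues_nonneg i
  rw [← cfc_comp_pow (fun x : ℝ => x ^ (1 / 4 : ℝ)) 4 N hcont.continuousOn hsa]
  have heq : (spectrum ℝ N).EqOn (fun x : ℝ => (x ^ 4) ^ (1 / 4 : ℝ)) id := by
    intro x hx
    simp only [id_eq, one_div, show (4 : ℝ) = ((4 : ℕ) : ℝ) by norm_num]
    exact Real.pow_rpow_inv_natCast (hspec x hx) (by norm_num)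
  rw [cfc_congr heq, cfc_id ℝ N hsa]

/-- **The positive fourth root of `B` is the corner transfer matrix** (over `Z^{1/4}`):
`A = cfc (·^{1/4}) B = Z^{-1/4} · ctm` — "quarter turns have positive roots". [folklore] -/
theorem cfc_quarter_bMat : cfc (fun x : ℝ => x ^ (1 / 4 : ℝ)) (bMat L β) =
    ((isingPartitionFunction (zdGraph 3) (box 3 L) β 0 .plus)⁻¹) ^ (1 / 4 : ℝ) • ctm L β := by
  set Z := isingPartitionFunction (zdGraph 3) (box 3 L) β 0 .plus with hZ
  have hZpos : 0 < Z := isingPartitionFunction_pos _ _ _ _ _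
  set c : ℝ := (Z⁻¹) ^ (1 / 4 : ℝ) with hc
  have hc0 : 0 ≤ c := Real.rpow_nonneg (inv_nonneg.2 hZpos.le) _
  have hc4 : c ^ 4 = Z⁻¹ := by
    rw [hc, one_div, show (4 : ℝ) = ((4 : ℕ) : ℝ) by norm_num]
    exact Real.rpow_inv_natCast_pow (inv_nonneg.2 hZpos.le) (by norm_num)
  rw [bMat_eq, ← hZ, ← hc4, ← smul_pow]
  exact cfc_rpow_quarter_pow_four ((ctm_posSemidef L β).smul hc0)

/-- **`QuarterTurnAnchors` at every inverse temperature.** For the box `{-L,…,L}³` with `+` boundary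
condition and zero field, with `P, E, Pr, B` as in the route statement and `A = B^{1/4}` the positive
fourth root, `Tr (A D(g₃) A D(g₂) A D(g₁) A D(g₀)) = ⟨∏_k g_k ((ω ∘ Rᵏ)|_P)⟩` for all observables
`g₀,…,g₃` of the wall configuration: `A = Z^{-1/4} ctm` and the corner-transfer-matrix trace formula
(Baxter 1976). [folklore] -/
theorem quarterTurnAnchors_beta :
    ∀ g : Fin 4 → ((↥(wallP L) → ℤˣ) → ℝ),
      Matrix.trace (cfc (fun x : ℝ => x ^ (1 / 4 : ℝ)) (bMat L β) * Matrix.diagonal (g 3) *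
        cfc (fun x : ℝ => x ^ (1 / 4 : ℝ)) (bMat L β) * Matrix.diagonal (g 2) *
        cfc (fun x : ℝ => x ^ (1 / 4 : ℝ)) (bMat L β) * Matrix.diagonal (g 1) *
        cfc (fun x : ℝ => x ^ (1 / 4 : ℝ)) (bMat L β) * Matrix.diagonal (g 0)) =
      isingExpect (zdGraph 3) (box 3 L) β 0 BoundaryCondition.plus
        (fun ω => ∏ k : Fin 4, g k (fun x => ω ((fun y : Site 3 => (![-(y 1), y 0, y 2] : Site 3))^[k] x.1))) := by
  intro g
  set Z := isingPartitionFunction (zdGraph 3) (box 3 L) β 0 .plus with hZ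
  have hZpos : 0 < Z := isingPartitionFunction_pos _ _ _ _ _
  set c : ℝ := (Z⁻¹) ^ (1 / 4 : ℝ) with hc
  have hc4 : c ^ 4 = Z⁻¹ := by
    rw [hc, one_div, show (4 : ℝ) = ((4 : ℕ) : ℝ) by norm_num]
    exact Real.rpow_inv_natCast_pow (inv_nonneg.2 hZpos.le) (by norm_num)
  rw [cfc_quarter_bMat, ← hZ, ← hc]
  -- transpose: the trace of the reversed word, with the symmetric `ctm`
  have hT : (c • ctm L β)ᵀ = c • ctm L β := by
    rw [Matrix.transpose_smul, ← Matrix.conjTranspose_eq_transpose_of_trivial, (ctm_isHermitian L β).eq]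
  rw [← Matrix.trace_transpose]
  simp only [Matrix.transpose_mul, Matrix.diagonal_transpose, hT, ← Matrix.mul_assoc]
  rw [trace_four_cycle]
  -- the expectation as a Boltzmann sum, and the trace formula
  have hmeas : Measurable fun ω : SpinConfig (Site 3) =>
      ∏ k : Fin 4, g k (fun x => ω ((fun y : Site 3 => (![-(y 1), y 0, y 2] : Site 3))^[k] x.1)) :=
    Finset.measurable_prod _ fun k _ =>
      measurable_comp_restrict (wallP L) (fun x => (fun y : Site 3 => (![-(y 1), y 0, y 2] : Site 3))^[k] x.1) (g k)
  rw [isingExpect, integral_isingMeasure _ _ _ _ _ hmeas, ← hZ]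
  have hm := sum_isingWeight_mul_eq L β (fun s => ∏ k, g k (s k))
  rw [show (∑ τ : ↥(box 3 L) → ℤˣ, isingWeight (zdGraph 3) (box 3 L) β 0 BoundaryCondition.plus τ *
      ∏ k : Fin 4, g k (fun x => glue (box 3 L) τ BoundaryCondition.plus
        ((fun y : Site 3 => (![-(y 1), y 0, y 2] : Site 3))^[k] x.1))) =
      ∑ τ : ↥(box 3 L) → ℤˣ, isingWeight (zdGraph 3) (box 3 L) β 0 .plus τ *
        (fun s : Fin 4 → (↥(wallP L) → ℤˣ) => ∏ k, g k (s k)) (fun k : Fin 4 => wallRes L k τ) from rfl, hm]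
  -- pull out the scalar `c⁴ = Z⁻¹`
  simp only [Matrix.smul_apply, smul_eq_mul, Finset.prod_mul_distrib, Finset.prod_const, Finset.card_univ,
    Fintype.card_fin, hc4]
  rw [div_eq_inv_mul, Finset.mul_sum]
  exact Finset.sum_congr rfl fun s _ => by ring

end

end Summit.CriticalPhenomena.Ising3DConformalLimit.QuarterTurnCTM

namespace Summit.CriticalPhenomena.Ising3DConformalLimit.Theorems

open Literature.Probability.LatticeModels
open Summit.CriticalPhenomena.Ising3DConformalLimit.QuarterTurnCTM

/-- **`QuarterTurnAnchors`** (item stmt-CriticalPhenomena-6495 of route `ModularQuarterTurn`), literally the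
route decl: Baxter's quarter-turn corner transfer matrix is the positive fourth root of the Gram kernel
`B` (up to `Z^{1/4}`), and the CTM trace formula — the case `β = β_c(3)` of `quarterTurnAnchors_beta`.
(Baxter 1976; Friedli–Velenik 2017 §3.1, §10.3.) [folklore] -/
theorem quarterTurnAnchors_proof :
    Summit.CriticalPhenomena.Ising3DConformalLimit.Theses.ModularQuarterTurn.QuarterTurnAnchors := by
  intro L
  exact quarterTurnAnchors_beta L (criticalBeta 3)

end Summit.CriticalPhenomena.Ising3DConformalLimit.Theorems
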